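import Literature.IUT.HodgeTheaters.InitialThetaData
import Literature.NumberTheory.GaloisRepresentations.NaturalIrrationalities
import HarnessLib

/-!
# [IUTchI] Definition 3.1 (e): the decomposition group `G_v̲ ⊆ G_K ⊆ G_F` along an embedding `F̄ ↪ K̄_v̲`

S. Mochizuki, *Inter-universal Teichmüller theory I*, §3, Definition 3.1 (e) (kurims final manuscript, May 2020,
pp. 62–63) [claim: Mochizuki2012, status: disputed]: "the various profinite groups `Π_(−)` admit natural outer
surjections onto the decomposition group `G_v ⊆ G_K := Gal(F̄/K)` determined, up to `G_K`-conjugacy, by `v`."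
The module docstring of `InitialThetaData.lean` (abc-iut-L5-t2, the REAL Def. 3.1) lists "the decomposition
groups `G_v ⊆ G_K` ((e))" as deliberately not carried there; this file supplies them, as pure Galois theory
over Mathlib (nothing of the series is asserted):
* `localToGlobal k ι : Gal(Ω/k) →* Gal(F̄/K)` for a `K`-field `k` (in print the completion `K_v̲`), an
  extension `Ω ⊇ k` (in print `K̄_v̲`) and a `K`-embedding `ι : F̄ → Ω` of the normal extension `F̄/K`
  (Mathlib `AlgEquiv.restrictNormalHom` along `ι`); `apply_localToGlobal` (`ι ∘ res σ = σ ∘ ι`),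
  `localToGlobal_unique`; **Krull-continuity** `continuous_localToGlobal` (Serre, *Cohomologie galoisienne*,
  II.§1.1 — the argument of the tree's `Literature/NumberTheory/EllipticCurves/Sha.lean`, `resGalOfEmb`, redone
  for an ABSTRACT algebraic closure `F̄` as in Def. 3.1 (a));
* `decompositionSubgroup k ι ⊆ Gal(F̄/K)` — "`G_v ⊆ G_K`" — and **"determined, up to `G_K`-conjugacy, by `v`"
  PROVED**: two embeddings `ι, ι'` differ by some `τ ∈ Gal(F̄/K)` (Mathlib `AlgHom.restrictNormal'`) and the
  restrictions / decomposition groups are `τ`-conjugate (`localToGlobal_conj`, `decompositionSubgroup_conj`);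
  `localEmb` = a chosen embedding (`IsAlgClosed.lift`);
* `galoisSubgroupOfEquiv : Gal(F̄/K) ≃* G_K` onto the subgroup `galoisSubgroupOf F K Fbar ⊆ G_F` of Def. 3.1
  (e) over which `ThetaGeometry` is typed (its Krull-continuity is the tree's
  `Literature.NumberTheory.GaloisRepresentations.continuous_restrictScalarsHom`), and `localToGF F k ι :
  Gal(Ω/k) →* G_F` (continuous) with image `decompositionSubgroupGF F k ι ≤ G_K` — the form consumed by the
  local arithmetic fundamental groups `Π_v̲ := Π_{X̲→_v̲}` of Def. 3.1 (f) (`InitialThetaDataLocalGroups.lean`).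
Injectivity of `Gal(K̄_v̲/K_v̲) → G_K` for a completion `K_v̲` (Krasner) is the tree's
`Literature.NumberTheory.EllipticCurves.resGalAux_injective_holds` (for `F̄ := K̄`) and is not needed here.
No statement of the paper is strengthened.
-/

noncomputable section

namespace Literature.IUT.HodgeTheaters

universe u v w w'

/-! ### Restriction of a local Galois group to `Gal(F̄/K)` along an embedding `ι : F̄ → Ω` -/

section LocalToGlobal

variable {K : Type v} [Field K] {Fbar : Type w} [Field Fbar] [Algebra K Fbar] [Normal K Fbar]
  {Ω : Type w'} [Field Ω] [Algebra K Ω]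
  (k : Type w') [Field k] [Algebra K k] [Algebra k Ω] [IsScalarTower K k Ω]
  (ι : Fbar →ₐ[K] Ω)

/-- The restriction `Gal(Ω/k) → Gal(F̄/K)`, `σ ↦ ι⁻¹ ∘ σ|_{ι(F̄)} ∘ ι`, along a `K`-embedding
`ι : F̄ → Ω` of the normal extension `F̄/K` into an extension `Ω` of the `K`-field `k` (Def. 3.1 (e): the
decomposition group "`G_v ⊆ G_K := Gal(F̄/K)`" is its image, for `k = K_v̲`, `Ω = K̄_v̲`): Mathlib's
`AlgEquiv.restrictNormalHom` for the tower `K ⊆ F̄ ⊆ Ω` defined by `ι`, after restriction of scalars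
from `k` to `K`. [cite: SerreGaloisCohomology1997, II.§1.1] -/
def localToGlobal : (Ω ≃ₐ[k] Ω) →* (Fbar ≃ₐ[K] Fbar) :=
  letI : Algebra Fbar Ω := ι.toRingHom.toAlgebra
  haveI : IsScalarTower K Fbar Ω := IsScalarTower.of_algebraMap_eq fun x => (ι.commutes x).symm
  (AlgEquiv.restrictNormalHom (F := K) (K₁ := Ω) Fbar).comp (AlgEquiv.restrictScalarsHom K)

/-- Defining property: `ι (localToGlobal ι σ x) = σ (ι x)`. [cite: SerreGaloisCohomology1997, II.§1.1] -/
theorem apply_localToGlobal (σ : Ω ≃ₐ[k] Ω) (x : Fbar) : ι (localToGlobal k ι σ x) = σ (ι x) := by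
  letI : Algebra Fbar Ω := ι.toRingHom.toAlgebra
  haveI : IsScalarTower K Fbar Ω := IsScalarTower.of_algebraMap_eq fun x => (ι.commutes x).symm
  exact AlgEquiv.restrictNormal_commutes (AlgEquiv.restrictScalars K σ) Fbar x

/-- Uniqueness: a `K`-automorphism `τ` of `F̄` with `ι ∘ τ = σ ∘ ι` is `localToGlobal ι σ` (`ι` is
injective). [cite: SerreGaloisCohomology1997, II.§1.1] -/
theorem localToGlobal_unique {σ : Ω ≃ₐ[k] Ω} {τ : Fbar ≃ₐ[K] Fbar} (h : ∀ x, ι (τ x) = σ (ι x)) :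
    τ = localToGlobal k ι σ :=
  AlgEquiv.ext fun x => ι.toRingHom.injective (by
    change ι (τ x) = ι (localToGlobal k ι σ x)
    rw [h, apply_localToGlobal])

/-- **Continuity** of `Gal(Ω/k) → Gal(F̄/K)` for the Krull topologies: the preimage of `Gal(F̄/L)` for
`L/K` finite contains `Gal(Ω/k(ι b₁, …, ι bₙ))` for a `K`-basis `(bᵢ)` of `L` (Serre, *Cohomologie
galoisienne*, II.§1.1; same argument as the tree's `continuous_resGalAuxOfEmb`).
[cite: SerreGaloisCohomology1997, II.§1.1] -/
theorem continuous_localToGlobal : Continuous (localToGlobal k ι) := by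
  apply continuous_of_continuousAt_one _ (continuousAt_def.mpr _)
  intro N hN
  rw [map_one] at hN
  obtain ⟨L', hfd, hO⟩ := (krullTopology_mem_nhds_one_iff K Fbar N).mp hN
  refine (krullTopology_mem_nhds_one_iff k Ω _).mpr ?_
  let b := Module.finBasis K L'
  let S : Set Ω := Set.range fun i => ι (b i)
  refine ⟨IntermediateField.adjoin k S, ?_, ?_⟩
  · refine IntermediateField.finiteDimensional_adjoin fun x hx => ?_
    obtain ⟨i, rfl⟩ := hx
    exact ((Normal.isIntegral (F := K) (K := Fbar) inferInstance (b i : Fbar)).map ι).tower_top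
  · intro σ hσ
    apply hO
    simp only [SetLike.mem_coe, IntermediateField.mem_fixingSubgroup_iff] at hσ ⊢
    intro y hy
    apply ι.toRingHom.injective
    change ι _ = ι _
    rw [apply_localToGlobal]
    have key : ∀ i, σ (ι (b i)) = ι (b i) := fun i =>
      hσ _ (IntermediateField.subset_adjoin k S ⟨i, rfl⟩)
    have := b.ext
      (f₁ := (AlgEquiv.restrictScalars K σ).toLinearMap ∘ₗ ι.toLinearMap ∘ₗ L'.val.toLinearMap)
      (f₂ := ι.toLinearMap ∘ₗ L'.val.toLinearMap) (fun i => by simpa using key i)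
    exact congr($this ⟨y, hy⟩)

/-- **"Determined up to `G_K`-conjugacy"** (Def. 3.1 (e)): two `K`-embeddings `ι, ι' : F̄ → Ω` differ by an
element `τ ∈ Gal(F̄/K)` (`ι ∘ τ = ι'`, Mathlib `AlgHom.restrictNormal'`), and then the two restrictions are
conjugate: `localToGlobal ι' σ = τ⁻¹ ∘ localToGlobal ι σ ∘ τ`. [cite: SerreGaloisCohomology1997, II.§1.1] -/
theorem localToGlobal_conj (ι' : Fbar →ₐ[K] Ω) : ∃ τ : Fbar ≃ₐ[K] Fbar, (∀ x, ι (τ x) = ι' x) ∧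
    ∀ σ : Ω ≃ₐ[k] Ω, localToGlobal k ι' σ = τ⁻¹ * localToGlobal k ι σ * τ := by
  letI : Algebra Fbar Ω := ι.toRingHom.toAlgebra
  haveI : IsScalarTower K Fbar Ω := IsScalarTower.of_algebraMap_eq fun x => (ι.commutes x).symm
  let τ : Fbar ≃ₐ[K] Fbar := ι'.restrictNormal' Fbar
  have hτ : ∀ x, ι (τ x) = ι' x := fun x => by
    change algebraMap Fbar Ω (ι'.restrictNormal Fbar x) = _
    rw [AlgHom.restrictNormal_commutes]
    rfl
  refine ⟨τ, hτ, fun σ => ?_⟩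
  symm
  refine localToGlobal_unique k ι' fun x => ?_
  calc ι' ((τ⁻¹ * localToGlobal k ι σ * τ) x) = ι (τ (τ.symm (localToGlobal k ι σ (τ x)))) :=
        (hτ _).symm
    _ = ι (localToGlobal k ι σ (τ x)) := by rw [AlgEquiv.apply_symm_apply]
    _ = σ (ι (τ x)) := apply_localToGlobal k ι σ (τ x)
    _ = σ (ι' x) := by rw [hτ]

/-- **Def. 3.1 (e): the decomposition group** "`G_v ⊆ G_K := Gal(F̄/K)` determined, up to
`G_K`-conjugacy, by `v`" — the image of `Gal(Ω/k) → Gal(F̄/K)` along `ι` (`k = K_v̲`, `Ω = K̄_v̲`).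
[claim: Mochizuki2012, status: disputed] -/
def decompositionSubgroup : Subgroup (Fbar ≃ₐ[K] Fbar) := (localToGlobal k ι).range

/-- The decomposition groups of two embeddings are conjugate in `Gal(F̄/K)` ("determined, up to
`G_K`-conjugacy"). [claim: Mochizuki2012, status: disputed] -/
theorem decompositionSubgroup_conj (ι' : Fbar →ₐ[K] Ω) : ∃ τ : Fbar ≃ₐ[K] Fbar,
    decompositionSubgroup k ι' = (decompositionSubgroup k ι).map (MulAut.conj τ⁻¹).toMonoidHom := by
  obtain ⟨τ, -, hτ⟩ := localToGlobal_conj k ι ι'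
  refine ⟨τ, ?_⟩
  ext g
  simp only [decompositionSubgroup, MonoidHom.mem_range, Subgroup.mem_map, MulEquiv.coe_toMonoidHom,
    MulAut.conj_apply, inv_inv, exists_exists_eq_and, hτ]

/-- A chosen `K`-embedding `F̄ → Ω` into an algebraically closed `Ω` (Mathlib `IsAlgClosed.lift`; any other
differs by an element of `Gal(F̄/K)`, `localToGlobal_conj`). [cite: SerreGaloisCohomology1997, II.§1.1] -/
def localEmb (Ω : Type w') [Field Ω] [Algebra K Ω] [IsAlgClosed Ω] : Fbar →ₐ[K] Ω := IsAlgClosed.lift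

end LocalToGlobal

/-! ### `Gal(F̄/K) ≅ G_K ⊆ G_F`, and `Gal(Ω/k) → G_F` -/

section GK

variable (F : Type u) {K : Type v} {Fbar : Type w} [Field F] [Field K] [Algebra F K] [Field Fbar]
  [Algebra F Fbar] [Algebra K Fbar] [IsScalarTower F K Fbar]

/-- Restriction of scalars `Gal(F̄/K) → G_F = Gal(F̄/F)` lands in `G_K ⊆ G_F` (`galoisSubgroupOf`, Def. 3.1
(e) "`G_K := Gal(F̄/K)`"). [claim: Mochizuki2012, status: disputed] -/
theorem restrictScalars_mem_galoisSubgroupOf (τ : Fbar ≃ₐ[K] Fbar) :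
    AlgEquiv.restrictScalars F τ ∈ galoisSubgroupOf F K Fbar := fun x => τ.commutes x

variable (K Fbar)

/-- **`Gal(F̄/K) ≃* G_K`**: restriction of scalars is an isomorphism onto `galoisSubgroupOf F K Fbar`
(injective: same underlying map; surjective: an `F`-automorphism fixing `K` pointwise is `K`-linear).
[claim: Mochizuki2012, status: disputed] -/
def galoisSubgroupOfEquiv : (Fbar ≃ₐ[K] Fbar) ≃* galoisSubgroupOf F K Fbar :=
  MulEquiv.ofBijective
    ((AlgEquiv.restrictScalarsHom F).codRestrict (galoisSubgroupOf F K Fbar)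
      (restrictScalars_mem_galoisSubgroupOf F))
    ⟨fun _ _ h => AlgEquiv.restrictScalarsHom_injective F (congrArg Subtype.val h),
      fun σ => ⟨AlgEquiv.ofRingEquiv (f := (σ : Fbar ≃ₐ[F] Fbar).toRingEquiv) (fun x => σ.2 x),
        Subtype.ext (AlgEquiv.ext fun _ => rfl)⟩⟩

/-- Values of `galoisSubgroupOfEquiv`: the same underlying automorphism. [claim: Mochizuki2012, status: disputed] -/
@[simp] theorem galoisSubgroupOfEquiv_apply (τ : Fbar ≃ₐ[K] Fbar) (x : Fbar) :
    ((galoisSubgroupOfEquiv F K Fbar τ : galoisSubgroupOf F K Fbar) : Fbar ≃ₐ[F] Fbar) x = τ x := rfl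

variable {K Fbar}
variable [Normal K Fbar] {Ω : Type w'} [Field Ω] [Algebra K Ω]
  (k : Type w') [Field k] [Algebra K k] [Algebra k Ω] [IsScalarTower K k Ω] (ι : Fbar →ₐ[K] Ω)

/-- **Def. 3.1 (e) towards the datum: `Gal(Ω/k) → G_F`** (`k = K_v̲`), the restriction along `ι` followed by
`Gal(F̄/K) ⊆ G_F`; its image is the decomposition group `G_v̲ ⊆ G_K ⊆ G_F`. [claim: Mochizuki2012, status: disputed] -/
def localToGF : (Ω ≃ₐ[k] Ω) →* (Fbar ≃ₐ[F] Fbar) :=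
  (AlgEquiv.restrictScalarsHom F).comp (localToGlobal k ι)

/-- Values of `localToGF`. [claim: Mochizuki2012, status: disputed] -/
theorem localToGF_apply (σ : Ω ≃ₐ[k] Ω) (x : Fbar) : localToGF F k ι σ x = localToGlobal k ι σ x := rfl

/-- `Gal(Ω/k) → G_F` lands in `G_K`. [claim: Mochizuki2012, status: disputed] -/
theorem localToGF_mem (σ : Ω ≃ₐ[k] Ω) : localToGF F k ι σ ∈ galoisSubgroupOf F K Fbar :=
  restrictScalars_mem_galoisSubgroupOf F (localToGlobal k ι σ)

/-- `Gal(Ω/k) → G_F` is continuous (Krull topologies). [claim: Mochizuki2012, status: disputed] -/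
theorem continuous_localToGF : Continuous (localToGF F k ι) :=
  (Literature.NumberTheory.GaloisRepresentations.continuous_restrictScalarsHom
    (k := F) (K := K) (Ω := Fbar)).comp (continuous_localToGlobal k ι)

/-- **Def. 3.1 (e): `G_v̲ ⊆ G_K`** inside `G_F`, the decomposition group of `v̲` (image of `Gal(Ω/k) → G_F`).
[claim: Mochizuki2012, status: disputed] -/
def decompositionSubgroupGF : Subgroup (Fbar ≃ₐ[F] Fbar) := (localToGF F k ι).range

/-- `G_v̲ ⊆ G_K`. [claim: Mochizuki2012, status: disputed] -/
theorem decompositionSubgroupGF_le : decompositionSubgroupGF F k ι ≤ galoisSubgroupOf F K Fbar := by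
  rintro _ ⟨σ, rfl⟩
  exact localToGF_mem F k ι σ

/-- `G_v̲ ⊆ G_F` is the image of `G_v̲ ⊆ Gal(F̄/K)` under restriction of scalars.
[claim: Mochizuki2012, status: disputed] -/
theorem decompositionSubgroupGF_eq_map :
    decompositionSubgroupGF F k ι = (decompositionSubgroup k ι).map (AlgEquiv.restrictScalarsHom F) :=
  MonoidHom.range_comp _ _

end GK

end Literature.IUT.HodgeTheaters

end
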